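import Summits.MatrixMultiplication.MatrixMultiplication.Theorems.AbelianSTPPCensusTB3StatRows2
import Summits.MatrixMultiplication.MatrixMultiplication.Theorems.AbelianSTPPCensusTD2StatRows2
import Summits.MatrixMultiplication.MatrixMultiplication.Theorems.AbelianSTPPCensusTAStatKMemberSound

/-!
# T_B static certificate, range `5216 … 5590` (k-member tree): soundness (the main estimate)

Cell mm-stpp (rung F-M1), tier T_B = «beat `2.375` (Coppersmith–Winograd)»; checker `AbelianSTPPCensusTB3StatDefs.lean`, data facts `AbelianSTPPCensusTB3StatRows(2).lean`, toolbox `…TAStatLemmas.lean`, tree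
`…TAStatKMember(Sound).lean`.  `sum_gain_le` = theory g12's fourth-range proof (`…TAStatDSound.lean`, numerals `5216/5590/314`, gains `gainOfTBY`) with the two-member
branch REPLACED by the tree branch: when `TAStatKM.walk3` answers with the tree cover `TAStatKM.coverK` at the bucket of `t*`, the row facts `TAStatKM.Hyps` are assembled
(domination of every member at every bucket `≤` that of `t*` via `dominatedAt`, the companions' U11 / U14 / E3 caps, the Grynkiewicz budget from any source member via
`budget_of_sorted`, completeness of the bucket lists via `mem_m2l`) and `TAStatKM.rootK_sound` closes the estimate.  `not_beats_of_cert` is in the leaf file.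
WHAT THIS IS NOT: no statement about STPP families beyond vM / U11-G / E3 of their shape data; no `ω`.
-/

set_option linter.dupNamespace false
set_option autoImplicit false

namespace Summit.MatrixMultiplication.MatrixMultiplication.Theorems.TB3Stat

open TECert (tableOK vol us tableOK_iff tableOK_mono)
open ShapeCert (gainOfTBY D)
open TB3StatData (E VL TB nl nb)
open TAStat (tm Entry e0 domP leP leW vpI p1I p2I p3I piece pcs vpCand vpThresh cover tm_sorted getD_drop_add pcs_sound
  grynkiewicz_budget'_A grynkiewicz_budget'_B grynkiewicz_budget'_C tm_eq_of_cases affine_between quad_between vp_mono p1_between p2_between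
  vpThresh_le capE_mul_le)

/-! ## The main estimate -/

set_option maxHeartbeats 4000000 in
/-- **Arithmetic core of the static t*-certificate.**  Table facts, domination of every sorted candidate and all checks passing on the volumes
`1 … 5590` (and completeness of the second-member lists) imply: every shape list that is `SieveAdmissible M`, `U11G M` and `E3Adm M`, with at least two members, at an order `5216 ≤ M ≤ 5590`,
has `Σ_i gainOfTBY (a_i b_i c_i) ≤ 10⁶ · M`. [original] -/
theorem sum_gain_le (hmono : monoOK nl nb = true)
    (hdom : ∀ V, 1 ≤ V → V ≤ 5590 → ∀ x ∈ triplesS V, domX V (gainOfTBY V) x = true)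
    (hm2 : ∀ V, 1 ≤ V → V ≤ 5590 → ∀ x ∈ triplesS V, m2f (bucketOf (x.1 * x.2.1)) = true → x ∈ m2l (bucketOf (x.1 * x.2.1)))
    {N M : ℕ} {a b c : Fin N → ℕ} (hN : 2 ≤ N) (hlo : 5216 ≤ M) (hM : M ≤ 5590)
    (hck : ∀ V, 1 ≤ V → V ≤ 5590 → ∀ x ∈ triplesS V, ∃ Lo Hi, Lo ≤ M ∧ M ≤ Hi ∧ Hi ≤ 5590 ∧ checkShape Lo Hi V (gainOfTBY V) x = true)
    (hS : SieveAdmissible M a b c) (hG : U11G M a b c) (hE : TAKnap575.E3Adm M a b c) :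
    ∑ i, gainOfTBY (a i * b i * c i) ≤ D * M := by
  classical
  have hS' := hS
  obtain ⟨h1, h2, -, h4, h5, h6, -⟩ := hS
  haveI : Nontrivial (Fin N) := Fin.nontrivial_iff_two_le.mpr hN
  have hcand : ∀ i, 1 ≤ a i ∧ 1 ≤ b i ∧ 1 ≤ c i ∧ tableOK Mtop (a i) (b i) (c i) = true := by
    intro i
    obtain ⟨ha, hb, hc, hV⟩ := h1 i
    obtain ⟨n1, n2, n3⟩ := h2 i
    obtain ⟨j, hj⟩ := exists_ne i
    obtain ⟨u1, u2, u3, -⟩ := h5 i j hj.symm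
    refine ⟨ha, hb, hc, tableOK_mono ((tableOK_iff _ _ _ _).mpr ⟨?_, n1, n2, n3, ?_, ?_, ?_⟩) hM⟩ <;>
      simp only [shapeVol] at hV u1 u2 u3 ⊢ <;> omega
  have hsort : ∀ i, ∃ y : ℕ × ℕ × ℕ, SCand y ∧ vol y = a i * b i * c i ∧ us y = a i * b i + b i * c i + c i * a i ∧
      y.1 + y.2.1 + y.2.2 = a i + b i + c i ∧ tm (a i, b i, c i) = y.1 * y.2.1 ∧
      ((y.1 = a i ∧ y.2.1 = min (c i) (b i) ∧ a i ≤ c i ∧ a i ≤ b i) ∨ (y.1 = b i ∧ y.2.1 = min (a i) (c i) ∧ b i ≤ a i ∧ b i ≤ c i) ∨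
        (y.1 = c i ∧ y.2.1 = min (b i) (a i) ∧ c i ≤ b i ∧ c i ≤ a i)) := by
    intro i
    obtain ⟨ha, hb, hc, ht⟩ := hcand i
    obtain ⟨y, hy, hv, hu, hs, hcs⟩ := exists_sorted (a i) (b i) (c i) ha hb hc ht
    exact ⟨y, hy, hv, hu, hs, tm_eq_of_cases hcs, hcs⟩
  choose ysh hysh using hsort
  obtain ⟨l, -, hl⟩ := Finset.exists_max_image Finset.univ (fun i => a i * b i * c i) ⟨⟨0, by omega⟩, Finset.mem_univ _⟩
  set Vl := a l * b l * c l with hVl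
  have hVlM : Vl + 1 ≤ M := by
    obtain ⟨j, hj⟩ := exists_ne l
    have := (h5 l j hj.symm).1; simp only [shapeVol] at this; have := (h1 l).1; omega
  have hVl5 : Vl ≤ 5590 := by omega
  have hVl1 : 1 ≤ Vl := Nat.mul_pos (Nat.mul_pos (h1 l).1 (h1 l).2.1) (h1 l).2.2.1
  obtain ⟨m, -, hm⟩ := Finset.exists_max_image Finset.univ (fun i => tm (a i, b i, c i)) ⟨⟨0, by omega⟩, Finset.mem_univ _⟩
  set ts := tm (a m, b m, c m) with hts
  obtain ⟨hym, hvm, hum, hsm, htmm, hcsm⟩ := hysh m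
  generalize hymd : ysh m = ym at hym hvm hum hsm htmm hcsm
  have hts1 : 1 ≤ ts := by
    rw [hts, htmm]; exact Nat.mul_pos hym.1 (le_trans hym.1 hym.2.1)
  have hts3 : ts * ts * ts ≤ Vl * Vl := by
    have hy3 : ym.1 * ym.2.1 ≤ ym.2.2 * ym.2.2 := Nat.mul_le_mul (le_trans hym.2.1 hym.2.2.1) hym.2.2.1
    have hvm' : a m * b m * c m ≤ Vl := hl m (Finset.mem_univ m)
    rw [hts, htmm]
    calc ym.1 * ym.2.1 * (ym.1 * ym.2.1) * (ym.1 * ym.2.1) ≤ ym.1 * ym.2.1 * (ym.1 * ym.2.1) * (ym.2.2 * ym.2.2) :=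
          Nat.mul_le_mul_left _ hy3
      _ = vol ym * vol ym := by simp only [vol]; ring
      _ ≤ Vl * Vl := by rw [hvm]; exact Nat.mul_le_mul hvm' hvm'
  have hts292 : ts ≤ 314 := by
    apply sentinel
    calc ts ^ 3 = ts * ts * ts := by ring
      _ ≤ Vl * Vl := hts3
      _ ≤ 5590 * 5590 := Nat.mul_le_mul hVl5 hVl5
      _ = 5590 ^ 2 := by norm_num
  set j := bucketOf ts with hj
  obtain ⟨hjnb, htbj, htbj1⟩ := bucketOf_specD (t := ts) (by omega) hts1
  obtain ⟨htp19, htptb⟩ := tp_facts hmono j hjnb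
  set t := tp j with ht
  have hsmall : 3 ≤ t → ym.1 < t := by
    intro ht3
    rcases htp19 with heq | h19
    · -- t = tb j: ym.1² ≤ ts < tb (j+1) ≤ t²
      by_contra hge; push Not at hge
      have ht3' : 3 ≤ tb j := by rw [← heq]; exact ht3
      have hsq : tb (j + 1) ≤ t * t := by rw [heq]; exact tb_sq j hjnb ht3'
      have hsq2 : t * t ≤ ym.1 * ym.2.1 := Nat.mul_le_mul hge (le_trans hge hym.2.1)
      rw [← htmm] at hsq2
      exact absurd (lt_of_le_of_lt hsq2 htbj1) (not_lt.2 hsq)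
    · -- 19 ≤ t: ym.1³ ≤ vol ym ≤ Vl < 19³
      have hvm' : a m * b m * c m ≤ Vl := hl m (Finset.mem_univ m)
      have hcube : ym.1 * ym.1 * ym.1 ≤ Vl := by
        calc ym.1 * ym.1 * ym.1 ≤ ym.1 * ym.2.1 * ym.2.2 :=
              Nat.mul_le_mul (Nat.mul_le_mul_left _ hym.2.1) (le_trans hym.2.1 hym.2.2.1)
          _ = vol ym := by simp only [vol]
          _ ≤ Vl := by rw [hvm]; exact hvm'
      have h18 : ym.1 ≤ 18 := by
        by_contra hc; push Not at hc
        have : 19 * 19 * 19 ≤ ym.1 * ym.1 * ym.1 := Nat.mul_le_mul (Nat.mul_le_mul hc hc) hc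
        omega
      omega
  have htle : t ≤ ym.1 * ym.2.1 := by rw [← htmm]; exact htptb.trans htbj
  obtain ⟨hy, hyv, hyu, hys, hytm, -⟩ := hysh l
  generalize hyd : ysh l = y at hy hyv hyu hys hytm
  have hmem : y ∈ triplesS Vl := by
    have := mem_triplesS (a := y.1) (b := y.2.1) (c := y.2.2) hy
    have e : y.1 * y.2.1 * y.2.2 = Vl := hyv
    rw [e] at this; exact this
  obtain ⟨Lo, Hi, hLoM, hMHi, hHiM, hchk⟩ := hck Vl hVl1 hVl5 y hmem
  have hL : max Lo (Vl + 1) ≤ M := by omega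
  simp only [checkShape, Bool.or_eq_true, Nat.blt_eq] at hchk
  rcases hchk with hbad | hwalk
  · exfalso; omega
  set j0 := bucketOf (y.1 * y.2.1) with hj0
  have htl_ts : y.1 * y.2.1 ≤ ts := by rw [← hytm]; exact hm l (Finset.mem_univ l)
  have htl1 : 1 ≤ y.1 * y.2.1 := Nat.mul_pos hy.1 (le_trans hy.1 hy.2.1)
  have hj0j : j0 ≤ j := bucketOf_monoD htl_ts (by omega)
  set i₀ := levOf Vl with hi₀
  have hi₀nl : i₀ < nl := (levOf_spec Vl hVl5).1
  have hlen : (E.getD i₀ []).length = nb := row_length i₀ hi₀nl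
  have hk : j - j0 < ((E.getD i₀ []).drop j0).length := by rw [List.length_drop, hlen]; omega
  have hcov := TAStatKM.walk3_sound tb m2l gainOfTBY (rowOf Vl) tp _ _ _ _ _ _ _ _ _ _ _ _ hwalk (j - j0) hk (fun k' hk' => by
    have h1 : tb (j0 + k') ≤ tb j := tb_mono (by omega) (by omega)
    have h2 : tb j ≤ ts := htbj
    cases hti : TAStat2M.tiOK Vl (tb (j0 + k')) with
    | false => rfl
    | true =>
      exfalso
      have hvm' : a m * b m * c m ≤ Vl := hl m (Finset.mem_univ m)
      have habb : ym.1 * ym.2.1 * ym.2.1 ≤ Vl := by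
        calc ym.1 * ym.2.1 * ym.2.1 ≤ ym.1 * ym.2.1 * ym.2.2 := Nat.mul_le_mul_left _ hym.2.2.1
          _ = vol ym := by simp only [vol]
          _ ≤ Vl := by rw [hvm]; exact hvm'
      have hlt := TAStat2M.tiOK_sound hti hym.1 hym.2.1 habb (by omega)
      rw [← htmm] at hlt
      omega)
  rw [getD_drop_add, show j0 + (j - j0) = j by omega] at hcov
  set e := ent i₀ j with he
  have hent : (E.getD i₀ []).getD j e0 = e := rfl
  rw [hent] at hcov
  set g := gainOfTBY Vl with hg
  have hdomi : ∀ i, 1 ≤ e.2.1 ∧ 1 ≤ e.2.2.2 ∧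
      gainOfTBY (a i * b i * c i) * e.2.1 ≤ e.1 * (a i * b i + b i * c i + c i * a i) ∧
      a i * b i * c i < t * (a i * b i + b i * c i + c i * a i) ∧
      gainOfTBY (a i * b i * c i) * e.2.2.2 ≤ e.2.2.1 * (t * (a i * b i + b i * c i + c i * a i) - a i * b i * c i) := by
    intro i
    obtain ⟨hyi, hvi, hui, -, htmi, -⟩ := hysh i
    have hvle : vol (ysh i) ≤ Vl := by rw [hvi]; exact hl i (Finset.mem_univ i)
    have htmle : tm (ysh i) ≤ ts := by
      rw [tm_sorted hyi.2.1 hyi.2.2.1, ← htmi]; exact hm i (Finset.mem_univ i)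
    have := dominated hmono hdom hyi hVl5 hvle hts1 (by omega) htmle
    rw [hvi, hui] at this
    exact this
  obtain ⟨hp1, hw1, -, -, -⟩ := hdomi l
  have esplit : ∀ f : Fin N → ℕ, ∑ q, f q = f l + ∑ q ∈ Finset.univ.erase l, f q :=
    fun f => (Finset.add_sum_erase _ _ (Finset.mem_univ l)).symm
  set p : Fin N → ℕ := fun q => a q * b q + b q * c q + c q * a q with hp
  have hpll : p l = us y := by rw [hyu]
  have hsumg : (∑ q ∈ Finset.univ.erase l, gainOfTBY (a q * b q * c q)) * e.2.1 ≤ e.1 * ∑ q ∈ Finset.univ.erase l, p q := by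
    rw [Finset.sum_mul, Finset.mul_sum]
    exact Finset.sum_le_sum fun q _ => (hdomi q).2.2.1
  obtain ⟨hA, hB, hC⟩ := h4 l
  have e2 : (∑ q, a q * (b q + c q)) + (∑ q, b q * (c q + a q)) + ∑ q, c q * (a q + b q) = 2 * ∑ q, p q := by
    rw [Finset.mul_sum, ← Finset.sum_add_distrib, ← Finset.sum_add_distrib]
    exact Finset.sum_congr rfl fun q _ => by simp only [hp]; ring
  have hdd : y.1 + y.2.1 + y.2.2 ≤ 2 * us y := by
    obtain ⟨y1, y12, y23, -⟩ := hy
    simp only [us, TECert.uu, TECert.vv, TECert.ww]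
    have e1 : y.1 ≤ y.1 * y.2.1 := Nat.le_mul_of_pos_right _ (by omega)
    have e2 : y.2.1 ≤ y.2.1 * y.2.2 := Nat.le_mul_of_pos_right _ (by omega)
    have e3 : y.2.2 ≤ y.2.2 * y.1 := Nat.le_mul_of_pos_right _ (by omega)
    omega
  have hsum1 : 2 * (∑ q ∈ Finset.univ.erase l, p q) + (2 * us y - (y.1 + y.2.1 + y.2.2)) ≤ 3 * M := by
    have s1 := esplit p
    rw [← hpll, hys]; rw [← hpll, hys] at hdd
    omega
  obtain ⟨hab, -, hbc, -, hca, -⟩ := h6 l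
  simp only [u14Sum, shapeVol] at hab hbc hca
  have hsplit3 : ∑ q ∈ Finset.univ.erase l, p q = (∑ q ∈ Finset.univ.erase l, a q * b q) +
      (∑ q ∈ Finset.univ.erase l, b q * c q) + ∑ q ∈ Finset.univ.erase l, c q * a q := by
    rw [← Finset.sum_add_distrib, ← Finset.sum_add_distrib]
  have hsum2 : (∑ q ∈ Finset.univ.erase l, p q) + 3 * Vl ≤ 3 * M := by rw [hsplit3]; omega
  rcases hcov with hcov | hcovK
  · ---------------------------------------------------------------- one-member cover: the third-range argument verbatim
    simp only [cover, Bool.or_eq_true, Nat.ble_eq] at hcov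
    set M1 := vpThresh g (us y) Vl t (max Lo (Vl + 1)) Hi e with hM1
    by_cases hVP : M1 ≤ M
    · ---------------------------------------------------------------- case U11-G
      have hM1H : M1 ≤ Hi := hVP.trans hMHi
      obtain ⟨ht3, hVtp, hslope, hvp1, hwl1⟩ := vpThresh_le hM1H
      have hvp : vpI g (us y) Vl t M e = true := vp_mono hslope hVP hvp1
      have hwl : t * us y - Vl ≤ t * M := hwl1.trans (Nat.mul_le_mul_left _ hVP)
      simp only [vpI, Nat.ble_eq] at hvp
      have hbud : t * (∑ i, p i) + 1 ≤ (∑ i, a i * b i * c i) + t * M + 2 * t ^ 2 := by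
        rcases hcsm with ⟨hy1, hy2, -, -⟩ | ⟨hy1, hy2, -, -⟩ | ⟨hy1, hy2, -, -⟩
        · exact grynkiewicz_budget'_A hS' hG m (by rw [← hy1]; exact hsmall ht3) (by rw [← hy1, ← hy2]; exact htle) ht3
        · exact grynkiewicz_budget'_B hS' hG m (by rw [← hy1]; exact hsmall ht3) (by rw [← hy1, ← hy2]; exact htle) ht3
        · exact grynkiewicz_budget'_C hS' hG m (by rw [← hy1]; exact hsmall ht3) (by rw [← hy1, ← hy2]; exact htle) ht3
      have hwj : ∀ q, a q * b q * c q < t * p q ∧ gainOfTBY (a q * b q * c q) * e.2.2.2 ≤ e.2.2.1 * (t * p q - a q * b q * c q) := by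
        intro q; obtain ⟨-, -, -, hlt, hW⟩ := hdomi q; exact ⟨hlt, hW⟩
      have hcore : (∑ q ∈ Finset.univ.erase l, (t * p q - a q * b q * c q)) + (t * us y - Vl) ≤ t * M + (2 * t * t - 1) := by
        have eW : (∑ q ∈ Finset.univ.erase l, (t * p q - a q * b q * c q)) + ∑ q ∈ Finset.univ.erase l, a q * b q * c q =
            ∑ q ∈ Finset.univ.erase l, t * p q := by
          rw [← Finset.sum_add_distrib]
          exact Finset.sum_congr rfl fun q _ => Nat.sub_add_cancel (hwj q).1.le
        have eT : ∑ q ∈ Finset.univ.erase l, t * p q = t * ∑ q ∈ Finset.univ.erase l, p q := (Finset.mul_sum _ _ _).symm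
        have s1 := esplit p
        have s2 := esplit (fun q => a q * b q * c q)
        rw [← hVl] at s2
        have hl1 := (hwj l).1
        rw [hpll, ← hVl] at hl1
        generalize hA : ∑ q ∈ Finset.univ.erase l, (t * p q - a q * b q * c q) = A at *
        generalize hB : ∑ q ∈ Finset.univ.erase l, a q * b q * c q = B at *
        generalize hC : ∑ q ∈ Finset.univ.erase l, p q = C at *
        generalize hTM : t * M = TM at *
        generalize hTp : t * us y = Tp at *
        generalize hTC : t * C = TC at *
        have e3 : t * (p l + C) = Tp + TC := by rw [← hTp, ← hTC, hpll]; ring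
        have e4 : 2 * t ^ 2 = 2 * t * t := by ring
        rw [s1, s2, e3, e4] at hbud
        omega
      have hsumw : e.2.2.1 * (∑ q ∈ Finset.univ.erase l, (t * p q - a q * b q * c q)) + e.2.2.1 * (t * us y - Vl) ≤
          e.2.2.1 * (t * M) + e.2.2.1 * (2 * t * t - 1) := by
        rw [← Nat.mul_add, ← Nat.mul_add]; exact Nat.mul_le_mul_left _ hcore
      have hsumg : (∑ q ∈ Finset.univ.erase l, gainOfTBY (a q * b q * c q)) * e.2.2.2 ≤
          e.2.2.1 * ∑ q ∈ Finset.univ.erase l, (t * p q - a q * b q * c q) := by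
        rw [Finset.sum_mul, Finset.mul_sum]
        exact Finset.sum_le_sum fun q _ => (hwj q).2
      rw [esplit (fun q => gainOfTBY (a q * b q * c q)), ← hVl]
      have hvp' : t * e.2.2.1 * M + (gainOfTBY Vl * e.2.2.2 + (2 * t * t - 1) * e.2.2.1) ≤
          D * e.2.2.2 * M + (t * us y - Vl) * e.2.2.1 := by simpa only [hg] using hvp
      have key : (gainOfTBY Vl + ∑ q ∈ Finset.univ.erase l, gainOfTBY (a q * b q * c q)) * e.2.2.2 ≤ D * M * e.2.2.2 := by
        rw [Nat.add_mul]
        linarith only [hsumg, hsumw, hvp']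
      exact Nat.le_of_mul_le_mul_right key hw1
    · ---------------------------------------------------------------- case vM
      push Not at hVP
      have hMhi : M ≤ min Hi (M1 - 1) := by omega
      rcases hcov with hle | hpc
      · exfalso; omega
      obtain ⟨m₁, m₂, hm0, hm1, hm2, hpiece⟩ : ∃ m₁ m₂, max Lo (Vl + 1) ≤ m₁ ∧ m₁ ≤ M ∧ M ≤ m₂ ∧
          piece g Vl (2 * us y - (y.1 + y.2.1 + y.2.2)) e m₁ m₂ = true := by
        rcases hpc with hp | hp
        · exact ⟨_, _, le_rfl, hL, hMhi, hp⟩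
        · exact pcs_sound g Vl _ e J _ _ hp M hL hMhi
      have hm1' : 1 ≤ m₁ := by have := le_max_right Lo (Vl + 1); omega
      rw [esplit (fun q => gainOfTBY (a q * b q * c q)), ← hVl, ← hg]
      simp only [piece, Bool.or_eq_true, Bool.and_eq_true, Nat.blt_eq] at hpiece
      rcases hpiece with (⟨hP1a, hP1b⟩ | ⟨hP2a, hP2b⟩) | ⟨⟨h2V, hP3a⟩, hP3b⟩
      · -- U11 cap
        have hP := p1_between hm1 hm2 hP1a hP1b
        simp only [p1I, Nat.ble_eq] at hP
        have key : (g + ∑ q ∈ Finset.univ.erase l, gainOfTBY (a q * b q * c q)) * (2 * e.2.1) ≤ D * M * (2 * e.2.1) := by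
          have hs1 := Nat.mul_le_mul_left e.1 hsum1
          rw [Nat.add_mul]
          generalize (∑ q ∈ Finset.univ.erase l, gainOfTBY (a q * b q * c q)) = S at hsumg ⊢
          generalize (∑ q ∈ Finset.univ.erase l, p q) = So at hsumg hs1
          generalize (2 * us y - (y.1 + y.2.1 + y.2.2)) = dd at hs1 hP
          generalize e.1 = gP at hsumg hs1 hP
          generalize e.2.1 = pP at hsumg hP ⊢
          have e1 : gP * (2 * So + dd) = 2 * (gP * So) + gP * dd := by ring
          rw [e1] at hs1
          generalize g = gg at hP ⊢
          generalize D = DD at hP ⊢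
          ring_nf at hsumg hs1 hP ⊢
          omega
        exact Nat.le_of_mul_le_mul_right key (by omega)
      · -- U14 cap
        have hP := p2_between hm1 hm2 hP2a hP2b
        simp only [p2I, Nat.ble_eq] at hP
        have key : (g + ∑ q ∈ Finset.univ.erase l, gainOfTBY (a q * b q * c q)) * e.2.1 ≤ D * M * e.2.1 := by
          have hs2 := Nat.mul_le_mul_left e.1 hsum2
          rw [Nat.add_mul]
          generalize (∑ q ∈ Finset.univ.erase l, gainOfTBY (a q * b q * c q)) = S at hsumg ⊢
          generalize (∑ q ∈ Finset.univ.erase l, p q) = So at hsumg hs2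
          generalize e.1 = gP at hsumg hs2 hP
          generalize e.2.1 = pP at hsumg hP ⊢
          have e1 : gP * (So + 3 * Vl) = gP * So + 3 * Vl * gP := by ring
          rw [e1] at hs2
          generalize g = gg at hP ⊢
          generalize D = DD at hP ⊢
          ring_nf at hsumg hs2 hP ⊢
          omega
        exact Nat.le_of_mul_le_mul_right key hp1
      · -- E3 cap (M < 2 Vl)
        have h2V' : M < 2 * Vl := by omega
        have hE3 := hE l h2V'
        rw [← hVl] at hE3
        have he3 := TAKnap575.sum_us_le_of_e3 (by omega) (by omega) (by omega) h2V' hE3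
        have hcap : ∑ q ∈ Finset.univ.erase l, p q ≤ (Vl * Vl / M + 3 * M) - 4 * Vl := by
          rw [hsplit3]; omega
        have hM1' : 1 ≤ M := by omega
        have hP := quad_between hm1' hm1 hm2 hP3a hP3b
        simp only [p3I, Nat.ble_eq] at hP
        have hce := capE_mul_le (V := Vl) (M := M) (by omega)
        have key : (g + ∑ q ∈ Finset.univ.erase l, gainOfTBY (a q * b q * c q)) * e.2.1 * M ≤ D * M * e.2.1 * M := by
          have h1' : (∑ q ∈ Finset.univ.erase l, gainOfTBY (a q * b q * c q)) * e.2.1 * M ≤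
              e.1 * (((Vl * Vl / M + 3 * M) - 4 * Vl) * M) := by
            calc (∑ q ∈ Finset.univ.erase l, gainOfTBY (a q * b q * c q)) * e.2.1 * M
                ≤ e.1 * (∑ q ∈ Finset.univ.erase l, p q) * M := Nat.mul_le_mul_right _ hsumg
              _ ≤ e.1 * ((Vl * Vl / M + 3 * M) - 4 * Vl) * M := Nat.mul_le_mul_right _ (Nat.mul_le_mul_left _ hcap)
              _ = e.1 * (((Vl * Vl / M + 3 * M) - 4 * Vl) * M) := by ring
          have hce' := Nat.mul_le_mul_left e.1 hce
          rw [Nat.add_mul, Nat.add_mul]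
          generalize (∑ q ∈ Finset.univ.erase l, gainOfTBY (a q * b q * c q)) = S at h1' ⊢
          generalize ((Vl * Vl / M + 3 * M) - 4 * Vl) = cE at h1' hce'
          generalize e.1 = gP at h1' hce' hP
          generalize e.2.1 = pP at h1' hP ⊢
          have e1 : gP * (cE * M + 4 * Vl * M) = gP * (cE * M) + 4 * Vl * M * gP := by ring
          rw [e1] at hce'
          have e2 : gP * (Vl * Vl + 3 * M * M) = Vl * Vl * gP + 3 * M * M * gP := by ring
          rw [e2] at hce'
          generalize g = gg at hP ⊢
          generalize D = DD at hP ⊢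
          ring_nf at h1' hce' hP ⊢
          omega
        have hpos : 0 < e.2.1 * M := Nat.mul_pos hp1 hM1'
        have key' : (g + ∑ q ∈ Finset.univ.erase l, gainOfTBY (a q * b q * c q)) * (e.2.1 * M) ≤ D * M * (e.2.1 * M) := by
          rw [← Nat.mul_assoc, ← Nat.mul_assoc]; exact key
        exact Nat.le_of_mul_le_mul_right key' hpos
  · ---------------------------------------------------------------- k-member tree at the bucket of t*
    have hrk := TAStatKM.coverK_at tb m2l gainOfTBY (rowOf Vl) hcovK hL hMHi
    have hVgen : ∀ q t', (ysh q).1 ≤ t' → a q * b q * c q ≤ t' * p q := fun q t' ht' => by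
      obtain ⟨hsc, hv, hu, -, -, -⟩ := hysh q; show a q * b q * c q ≤ t' * (a q * b q + b q * c q + c q * a q)
      rw [← hv, ← hu]; exact vol_le_of_small hsc ht'
    have hdomAt : ∀ j' ≤ j, ∀ q, (ysh q).1 * (ysh q).2.1 ≤ tb (j' + 1) - 1 →
        gainOfTBY (a q * b q * c q) * (rowOf Vl j').2.1 ≤ (rowOf Vl j').1 * p q ∧ a q * b q * c q < tb j' * p q ∧
        gainOfTBY (a q * b q * c q) * (rowOf Vl j').2.2.2 ≤ (rowOf Vl j').2.2.1 * (tb j' * p q - a q * b q * c q) := by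
      intro j' hj' q htq; obtain ⟨hsc, hv, hu, -, -, -⟩ := hysh q
      have hd := dominatedAt (j := j') hmono hdom hsc hVl5 (by rw [hv]; exact hl q (Finset.mem_univ q)) (by omega)
        (by rw [tm_sorted hsc.2.1 hsc.2.2.1]; exact htq)
      rw [hv, hu] at hd; exact hd
    have H : TAStatKM.Hyps l (fun q => gainOfTBY (a q * b q * c q)) p (fun q => a q * b q * c q) (fun q => (ysh q).1)
        (fun q => (ysh q).1 * (ysh q).2.1) ysh tb m2l gainOfTBY (rowOf Vl) g (us y) Vl (2 * us y - (y.1 + y.2.1 + y.2.2)) y.1 (y.1 * y.2.1) M j :=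
      { ysh_vol := fun q => (hysh q).2.1
        ysh_us := fun q => (hysh q).2.2.1
        ysh_a := fun _ => rfl
        ysh_t := fun _ => rfl
        gain_eq := fun _ => rfl
        gl := rfl
        pl := hpll
        Vl := rfl
        al_eq := by show (ysh l).1 = y.1; rw [hyd]
        tl_eq := by show (ysh l).1 * (ysh l).2.1 = y.1 * y.2.1; rw [hyd]
        Vle := fun q => hl q (Finset.mem_univ q)
        Vgen := hVgen
        ppos := fun q => by have : 1 ≤ a q * b q := Nat.mul_pos (h1 q).1 (h1 q).2.1; simp only [hp]; omega
        domP := fun j' hj' q _ htq => (hdomAt j' hj' q htq).1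
        domW := fun j' hj' q _ htq => (hdomAt j' hj' q htq).2
        den := fun j' hj' => ⟨(mono_P_bkt hmono (le_refl j') (by omega) hi₀nl).2, (mono_W_lev hmono (le_refl i₀) hi₀nl (by omega)).2⟩
        tbmono := tb_le_succ
        tbsmall := tb_lt_million
        complete := fun q hql j' hj' hlo hhi => by
          obtain ⟨hsc, hv, -, -, -, -⟩ := hysh q
          exact mem_m2l hm2 hsc (by rw [hv]; exact Nat.mul_pos (Nat.mul_pos (h1 q).1 (h1 q).2.1) (h1 q).2.2.1)
            (by rw [hv]; exact (hl q (Finset.mem_univ q)).trans hVl5) (by omega) hlo hhi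
        sum1 := hsum1
        sum2 := hsum2
        cap := fun h2V' => by
          have hE3 := hE l h2V'; rw [← hVl] at hE3
          have he3 := TAKnap575.sum_us_le_of_e3 (by omega) (by omega) (by omega) h2V' hE3; rw [hsplit3]; omega
        bud := fun t' ht3 hsrc => by
          obtain ⟨q, hq1, hq2⟩ := hsrc
          have hbud := TD2Stat.budget_of_sorted hS' hG q (hysh q).2.2.2.2.2 hq1 hq2 ht3
          have s1 := esplit p; have s2 := esplit (fun q => a q * b q * c q)
          rw [← hVl] at s2; simp only [hp] at s1; rw [s1, s2, ← hyu] at hbud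
          generalize (∑ q ∈ Finset.univ.erase l, (a q * b q + b q * c q + c q * a q)) = P1 at hbud ⊢
          generalize (∑ q ∈ Finset.univ.erase l, a q * b q * c q) = V1 at hbud ⊢
          have e4 : 2 * t' ^ 2 = 2 * t' * t' := by ring
          have e5 : t' * (us y + P1) = t' * (P1 + us y) := by ring
          rw [e4, e5] at hbud; omega
        two := exists_ne l }
    have hout : ∀ q, q ≠ l → (ysh q).1 * (ysh q).2.1 ≤ tb (j + 1) - 1 := by
      intro q _; have h1' := hm q (Finset.mem_univ q)
      rw [(hysh q).2.2.2.2.1] at h1'; change (ysh q).1 * (ysh q).2.1 ≤ ts at h1'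
      have h2' : ts < tb (j + 1) := htbj1; omega
    have hroot := fun h3 : 3 ≤ tb j => (⟨m, by rw [hymd]; exact hsmall h3, by rw [hymd]; exact htle⟩ : ∃ q, (ysh q).1 < tb j ∧ tb j ≤ (ysh q).1 * (ysh q).2.1)
    have habove : j0 < j → ∃ q, q ≠ l ∧ tb j ≤ (ysh q).1 * (ysh q).2.1 := by
      intro hj0j; refine ⟨m, fun hml' => ?_, by rw [hymd, ← htmm]; exact htbj⟩
      have e1 : ts = y.1 * y.2.1 := by rw [hts, hml', hytm]
      have : j = j0 := by rw [hj, hj0, e1]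
      omega
    rw [esplit (fun q => gainOfTBY (a q * b q * c q)), ← hVl, ← hg]
    exact TAStatKM.rootK_sound H le_rfl hout hroot habove hrk

end Summit.MatrixMultiplication.MatrixMultiplication.Theorems.TB3Stat
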